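import Summits.BirchSwinnertonDyer.Rank1Residual.Additive.IntModelTamagawaCertificate
import Literature.NumberTheory.EllipticCurves.TamagawaRingEquivProofs
import HarnessLib

/-!
# The LOCAL Tamagawa number `c_p = c(W / ℚ_p)` over Mathlib's `ℤ_[p]` of a curve given by its
# INTEGRAL MODEL, from ONE kernel certificate of the rank-2 observatory (`TamLocal` / `TamX` /
# `TamZ`) — bridge lemmas for the `hcov` Tamagawa READING of the per-pair defect-row records of team
# n1011 (cell `b2b-bsdres`, seat p03, OWNERS row T-a2-REC; kernel TOOL, data-free; sequel of
# `IntModelTamagawaCertificate`)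

HONEST FRAMING (cell `b2b-bsdres`, run/shared/lean/b2b/bsd-rank1-residual/, verbatim in every
file): the goal of the cell is to DELETE the COMBINATION-SHAPED residual classes of the
Birch–Swinnerton-Dyer formula for ALL analytic-rank `≤ 1` elliptic curves over `ℚ` — "full BSD
formula for every rank `≤ 1` curve in class `C`" assembled STRICTLY from published theorems — so
that the rank-`≤ 1` remainder becomes exactly the CONSTRUCTION-SHAPED classes, which are TYPED
(missing-input `Prop`s), NOT attempted. This is not "finishing BSD". Team n1011 is a RESEARCH ROUTE;
no claim beyond the stated classes; nothing is booked by this file. Theorems only (no definition, no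
named fact, no axiom).

## What this file does

The Tamagawa-DEFECT record shapes (`X4RankZero.bsdp_three_of_optimal[_of_towerSurj]_of_kuriharaIndexLeAt_of_cov`)
carry, on potentially GOOD rows, the covered-locus binder
`hcov : ord₃ j < 0 ∨ ord₃ ∏ c_ℓ = ord₃ c(W / ℚ_[3])` — the right disjunct is the TAMAGAWA READING of the
row (sharp Kato A161), so far read off Cremona's table. Its right-hand side is the local Tamagawa number
over Mathlib's `ℚ_[3]` / `ℤ_[3]`, while the observatory's certificates compute
`tam W₀ v = c(W₀ ⊗ ℚ ⊗ ℚ_v)` at the PLACE `v` of `𝓞 ℚ`; the tree's THEOREM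
`WeierstrassCurve.localTamagawaNumber_padic_eq_holds` (transport along `adicCompletion.padicEquiv`)
identifies the two. Hence:
* `localTamagawaNumber_padic_eq_tam_of_intModel`: `c(W / ℚ_[p]) = tam W₀ (pl p)` for
  `integralModelInt W = W₀`;
* `localTamagawaNumber_padic_eq_of_intModel_of_tamLocal` (stage-1 certificate with a singleton value
  set: multiplicative, `II`, `III`, `III*`, `II*`), `…_of_tamX` (`IV`, `IV*`), `…_of_tamZ` (`I₀*`, `Iₙ*`):
  `c(W / ℚ_[p])` as a kernel numeral from ONE `decide`-able certificate;
* `padicValNat_eq_padicValNat_of_eq_mul`: the arithmetic step `ord_p (c·m) = ord_p c` for `p ∤ m`,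
  so that the reading `ord₃ ∏ c_ℓ = ord₃ c₃` closes by `norm_num` once both sides are numerals.
E2-AT3 STAGE 2 (74 rows, `tools/STAGE2-TAMCERT.tsv`): 69 UNIT rows; 5 defect rows — `13221g1`
potentially multiplicative (`hcov` left disjunct by `JValuationOfIntModel`), `11286q1`, `15930u1`,
`19656b1` potentially good with `c₃ = 3` (types `IV` / `IV*`, `TamX`) and the reading TRUE — `hcov`
becomes a kernel certificate —, `17127b1` potentially good with the reading FALSE (`c₃ = 2`, a split `I₃`
at `173`): outside the covered locus, LOWER half only (as designed).

References: J. Tate, LNM 476 (1975) §7 [Tate1975]; J. H. Silverman, *Advanced Topics*, GTM 151 (1994),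
IV.9.4 [Silverman1994]; J. H. Silverman, *AEC* 2nd ed. (2009), VII.1 Prop. 1.3(b), VII.6 Ex. 7.6, VIII.8
[SilvermanAEC2009]; J. E. Cremona, *Algorithms for Modular Elliptic Curves* (1997) §3.2 [CremonaAlgorithms1997].
-/

set_option autoImplicit false

open scoped NumberField
open WeierstrassCurve IsDedekindDomain
open Summit.BirchSwinnertonDyer.BirchSwinnertonDyer.Rank2Observatory.Tam

namespace Summit.BirchSwinnertonDyer.Rank1Residual.Additive.IntModelTam

section

variable {W : WeierstrassCurve ℚ} [W.IsElliptic] [W.IsGloballyMinimal] {W₀ : WeierstrassCurve ℤ}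

/-- **`c(W / ℚ_[p]) = c_v(W₀ ⊗ ℚ)` at the place `v = pl p`** for a globally minimal `W / ℚ` with integral
model `W₀`: the tree's transport theorem `localTamagawaNumber_padic_eq_holds` plus `W = W₀ ⊗ ℚ`.
[cite: SilvermanAEC2009, VII.6 Ex. 7.6 and VII.1 Prop. 1.3(b)] -/
theorem localTamagawaNumber_padic_eq_tam_of_intModel (hI : integralModelInt W = W₀) (p : ℕ)
    [hp : Fact p.Prime] : (W.baseChange ℚ_[p]).localTamagawaNumber ℤ_[p] = tam W₀ (pl p) := by
  rw [localTamagawaNumber_padic_eq_holds W (pl p) p (natGenerator_pl hp.out),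
    eq_baseChange_of_integralModelInt hI]

/-- **`c(W / ℚ_[p])` from a stage-1 certificate with a singleton value set** (`p` multiplicative, or of
Kodaira type `II`, `III`, `III*`, `II*`): `c(W / ℚ_[p]) = c`. [cite: Silverman1994, IV.9.4] -/
theorem localTamagawaNumber_padic_eq_of_intModel_of_tamLocal (hI : integralModelInt W = W₀) (p : ℕ)
    [hp : Fact p.Prime] {E : TamLocal} (hEp : E.p = p) (hc : E.check W₀ = true) {c : ℕ}
    (h1 : E.vals = [c]) : (W.baseChange ℚ_[p]).localTamagawaNumber ℤ_[p] = c := by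
  have hGM : (W₀.baseChange ℚ).IsGloballyMinimal := eq_baseChange_of_integralModelInt hI ▸ ‹_›
  rw [localTamagawaNumber_padic_eq_tam_of_intModel hI p]
  exact TamLocal.sound_exact (pl p) ((natGenerator_pl hp.out).trans hEp.symm) (hGM.isMinimal _) hc h1

/-- **`c(W / ℚ_[p])` from an exact certificate `TamX`** (Kodaira type `IV` / `IV*`: `3` by a root witness,
`1` by exhaustion): `c(W / ℚ_[p]) = F.c`. [cite: Silverman1994, IV.9.4 Steps 5, 8] -/
theorem localTamagawaNumber_padic_eq_of_intModel_of_tamX (hI : integralModelInt W = W₀) (p : ℕ)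
    [hp : Fact p.Prime] {F : TamX} (hFp : F.p = p) (hc : F.check W₀ = true) :
    (W.baseChange ℚ_[p]).localTamagawaNumber ℤ_[p] = F.c := by
  have hGM : (W₀.baseChange ℚ).IsGloballyMinimal := eq_baseChange_of_integralModelInt hI ▸ ‹_›
  rw [localTamagawaNumber_padic_eq_tam_of_intModel hI p]
  exact TamX.sound (pl p) ((natGenerator_pl hp.out).trans hFp.symm) (hGM.isMinimal _) hc

/-- **`c(W / ℚ_[p])` from a kernel certificate `TamZ`** (Kodaira type `I₀*`: `1 + #roots` of Tate's cubic;
`Iₙ*`: `4` by a root witness of the exit quadratic, `2` by exhaustion): `c(W / ℚ_[p]) = F.c`.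
[cite: Tate1975, §7] [cite: Silverman1994, IV.9.4 Steps 6–7] -/
theorem localTamagawaNumber_padic_eq_of_intModel_of_tamZ (hI : integralModelInt W = W₀) (p : ℕ)
    [hp : Fact p.Prime] {F : TamZ} (hFp : F.p = p) (hc : F.check W₀ = true) :
    (W.baseChange ℚ_[p]).localTamagawaNumber ℤ_[p] = F.c := by
  have hGM : (W₀.baseChange ℚ).IsGloballyMinimal := eq_baseChange_of_integralModelInt hI ▸ ‹_›
  rw [localTamagawaNumber_padic_eq_tam_of_intModel hI p]
  exact TamZ.sound (pl p) ((natGenerator_pl hp.out).trans hFp.symm) (hGM.isMinimal _) hc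

end

/-- Arithmetic of the Tamagawa READING: `ord_p a = ord_p b` when `a = b · m` with `p ∤ m` (e.g.
`ord₃ ∏_ℓ c_ℓ = ord₃ c₃` when no `c_ℓ`, `ℓ ≠ 3`, is divisible by `3`). [folklore] -/
theorem padicValNat_eq_padicValNat_of_eq_mul {p a b m : ℕ} (hp : p.Prime) (h : a = b * m) (hb : b ≠ 0)
    (hm : ¬ p ∣ m) : padicValNat p a = padicValNat p b := by
  haveI := Fact.mk hp
  subst h
  have hm0 : m ≠ 0 := by rintro rfl; exact hm (dvd_zero p)
  rw [padicValNat.mul hb hm0, padicValNat.eq_zero_of_not_dvd hm, add_zero]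

/-! ### Kernel self-test on a cell row: Cremona's `11286q1` (N11 Tamagawa-DEFECT row of E2-AT3 STAGE 2) -/

/-- Row certificate of `11286q1 = [1, -1, 0, -738665151, -7726968643699]` (`N = 11286 = 2·3³·11·19`,
`Δ = 2¹³·3⁹·11²·19⁷`): `2` of type `I₁₃` non-split (`c₂ = 1`), `3` of type `IV*` (deep Tate certificate after
`(r, s, t) = (7, 1, 10)`; the Step-8 quadratic HAS a residue root `1`: `c₃ = 3` by the exact certificate
`TamX` kind `3`), `11` of type `I₂` non-split (`c₁₁ = 2`), `19` of type `I₇` non-split (`c₁₉ = 1`) — kernel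
value `∏ c_ℓ = 6` (Cremona's table: `6`). [cite: Silverman1994, IV.9.4 Step 8] [cite: CremonaAlgorithms1997, Table 1] -/
theorem rowCheckZ_v11286q1 :
    TamZ.rowCheckZ [⟨2, 1, 2, 0, 0, 0, 0, 13, 0, 0, 1⟩, ⟨3, 1, 5, 0, 7, 1, 10, 9, 8, 0, 3⟩,
        ⟨11, 3, 3, 0, 0, 0, 0, 2, 0, 0, 2⟩, ⟨19, 4, 3, 0, 0, 0, 0, 7, 0, 0, 1⟩] [⟨3, 1, 3, 7, 1, 10, 9, 1⟩] []
      ⟨1, -1, 0, -738665151, -7726968643699⟩ = true := by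
  decide +kernel

/-- **`∏_ℓ c_ℓ (11286q1) = 6` IN THE KERNEL.** [cite: Silverman1994, IV.9.4] [cite: CremonaAlgorithms1997, Table 1] -/
theorem tamagawaProduct_v11286q1 {W : WeierstrassCurve ℚ} [W.IsGloballyMinimal]
    (hI : integralModelInt W = ⟨1, -1, 0, -738665151, -7726968643699⟩) : W.tamagawaProduct = 6 :=
  (tamagawaProduct_eq_rowValueZ_of_intModel hI rowCheckZ_v11286q1 (by decide +kernel)).trans
    (by decide +kernel)

/-- **`c(W / ℚ_[3]) (11286q1) = 3` IN THE KERNEL** (type `IV*`, root witness). [cite: Silverman1994, IV.9.4 Step 8] -/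
theorem localTamagawaNumber_three_v11286q1 {W : WeierstrassCurve ℚ} [W.IsElliptic] [W.IsGloballyMinimal]
    (hI : integralModelInt W = ⟨1, -1, 0, -738665151, -7726968643699⟩) :
    haveI : Fact (Nat.Prime 3) := ⟨Nat.prime_three⟩
    (W.baseChange ℚ_[3]).localTamagawaNumber ℤ_[3] = 3 :=
  haveI : Fact (Nat.Prime 3) := ⟨Nat.prime_three⟩
  localTamagawaNumber_padic_eq_of_intModel_of_tamX hI 3 (F := ⟨3, 1, 3, 7, 1, 10, 9, 1⟩) rfl
    (by decide +kernel)

/-- **The Tamagawa READING `ord₃ ∏ c_ℓ = ord₃ c₃` for `11286q1` IN THE KERNEL** (`6 = 3·2`, `3 ∤ 2`):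
the right disjunct of the covered-locus binder `hcov` of the defect-row records, for any globally minimal
elliptic `W` with this integral model. [cite: Silverman1994, IV.9.4] [cite: CremonaAlgorithms1997, Table 1] -/
theorem tamagawaReading_v11286q1 {W : WeierstrassCurve ℚ} [W.IsElliptic] [W.IsGloballyMinimal]
    (hI : integralModelInt W = ⟨1, -1, 0, -738665151, -7726968643699⟩) :
    haveI : Fact (Nat.Prime 3) := ⟨Nat.prime_three⟩
    padicValRat 3 W.j < 0 ∨
      padicValNat 3 W.tamagawaProduct = padicValNat 3 ((W.baseChange ℚ_[3]).localTamagawaNumber ℤ_[3]) := by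
  refine Or.inr ?_
  rw [tamagawaProduct_v11286q1 hI, localTamagawaNumber_three_v11286q1 hI]
  exact padicValNat_eq_padicValNat_of_eq_mul (m := 2) Nat.prime_three rfl (by norm_num) (by norm_num)

end Summit.BirchSwinnertonDyer.Rank1Residual.Additive.IntModelTam
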